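import Literature.Probability.Percolation.DislocationLoopCover
import Mathlib.Analysis.SpecificLimits.Basic
import Mathlib.Topology.Algebra.InfiniteSum.ENNReal
import HarnessLib

/-!
# `PercLoopDislocationCovers.CoverSubcritTransfer` (stmt-CriticalPhenomena-13952) — II: chain sums

RSW3 lane (lead, gen 31).  Helper lemmas for item `stmt-CriticalPhenomena-13952` (route `PercLoopDislocationCovers`): the
ANALYTIC side of the cluster-of-clusters expansion on the cover `G_s` — pure `[0, ∞]`-analysis, no probability.  Abstract data:
a patch family `PV : label → site → Prop` on `ℤ³` (labels `ℤ × ℤ × ℤ`) with at most `N` sites per label and at most one label per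
site, a word action `op`, a translation-invariant link kernel `T` on `ℤ³`, and a decay parameter `ν ≤ 1/3` with
`T(u − z) ≤ ν^{2‖P′ − P‖₁}` whenever `z`, `u` lie over DISTINCT labels `P ≠ P′`.  A chain of `k` core visits
`c_i = (P_i, a_i, b_i)` from the vertex `σ` (entries/exits `a_i, b_i ∈ ℤ³ × words` over patch `P_i`, exit word ∈ {entry word, its
`op P_i`-image}, entry word = previous exit word, no two consecutive labels equal, first label in `R`) to an endpoint `x` carrying
the last word has weight `Π_i T(a_i.1 − b_{i−1}.1) · T(x.1 − b_{k−1}.1)`; the level sum `L_k(σ; R)` sums this over chains and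
endpoints.

* `levelSum_succ` / `levelSum_zero` — first-visit recurrence `L_{k+1}(σ; R) = Σ_{c₀} T(a₀.1 − σ.1) L_k(b₀; · ≠ P₀)` (`Fin.cons`)
  and `L_0 = χ_T := Σ_v T(v)`;
* `step_le` — from an exit over patch `P`, the first-visit sum over labels `≠ P` is `≤ m := 2 N² · 27 ν`
  (`Σ_{Q ∈ ℤ³} ν^{‖Q‖₁} ≤ 27`, `tsum_pow_norm_le`); `root_le` — from any vertex, `≤ 2 N χ_T` (one label per site);
* `levelSum_le_pow`, `levelSum_succ_le`, `tsum_levelSum_le` — `Σ_k L_k(σ; ⊤) ≤ χ_T + 2 N χ_T² (1 − m)⁻¹`.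

No definitions, no sorries.  References: M. Aizenman, C. M. Newman, J. Stat. Phys. 36 (1984) §4 [AizenmanNewman1984];
G. Grimmett, *Percolation* (1999), §2.3 (2.17), §6.3 [GrimmettPercolation1999].
-/

noncomputable section

namespace Summit.CriticalPhenomena.PercolationContinuityZ3.Theorems

namespace CoverSubcritTransfer

open Literature.Probability.LatticeModels
open scoped ENNReal

variable (PV : (ℤ × ℤ × ℤ) → Site 3 → Prop) (op : (ℤ × ℤ × ℤ) → List (ℤ × ℤ × ℤ) → List (ℤ × ℤ × ℤ))
  (T : Site 3 → ℝ≥0∞)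

/-! ### Counting lemmas -/

/-- At most `N` sites over a label: a sum over the patch of a function bounded by `B` there is `≤ N B`. [folklore] -/
theorem tsum_indicator_le_mul {N B : ℝ≥0∞} {P : ℤ × ℤ × ℤ}
    (hN : ∑' u : Site 3, {u : Site 3 | PV P u}.indicator (fun _ => (1 : ℝ≥0∞)) u ≤ N)
    {g : Site 3 → ℝ≥0∞} (hg : ∀ u, PV P u → g u ≤ B) :
    ∑' u : Site 3, {u : Site 3 | PV P u}.indicator g u ≤ N * B := by
  classical
  calc ∑' u : Site 3, {u : Site 3 | PV P u}.indicator g u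
      ≤ ∑' u : Site 3, {u : Site 3 | PV P u}.indicator (fun _ => (1 : ℝ≥0∞)) u * B := by
        refine ENNReal.tsum_le_tsum fun u => ?_
        simp only [Set.indicator_apply, Set.mem_setOf_eq]
        split_ifs with h
        · rw [one_mul]; exact hg u h
        · rw [zero_mul]
    _ ≤ N * B := by rw [ENNReal.tsum_mul_right]; exact mul_le_mul_left hN B

/-- Two words: `Σ_w [w = w₁ ∨ w = w₂] C ≤ 2 C`. [folklore] -/
theorem tsum_indicator_two_words_le (w₁ w₂ : List (ℤ × ℤ × ℤ)) (C : ℝ≥0∞) :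
    ∑' w : List (ℤ × ℤ × ℤ), {w : List (ℤ × ℤ × ℤ) | w = w₁ ∨ w = w₂}.indicator (fun _ => C) w ≤ 2 * C := by
  classical
  have h1 : ∀ w₀ : List (ℤ × ℤ × ℤ),
      ∑' w : List (ℤ × ℤ × ℤ), {w : List (ℤ × ℤ × ℤ) | w = w₀}.indicator (fun _ => C) w = C := by
    intro w₀
    rw [tsum_eq_single w₀ fun w hw => by rw [Set.indicator_of_notMem]; exact hw]
    rw [Set.indicator_of_mem (show w₀ ∈ {w : List (ℤ × ℤ × ℤ) | w = w₀} from rfl)]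
  calc ∑' w : List (ℤ × ℤ × ℤ), {w : List (ℤ × ℤ × ℤ) | w = w₁ ∨ w = w₂}.indicator (fun _ => C) w
      ≤ ∑' w : List (ℤ × ℤ × ℤ), ({w : List (ℤ × ℤ × ℤ) | w = w₁}.indicator (fun _ => C) w +
          {w : List (ℤ × ℤ × ℤ) | w = w₂}.indicator (fun _ => C) w) := by
        refine ENNReal.tsum_le_tsum fun w => ?_
        simp only [Set.indicator_apply, Set.mem_setOf_eq]
        by_cases ha : w = w₁
        · rw [if_pos (Or.inl ha), if_pos ha]; exact le_self_add
        · by_cases hb : w = w₂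
          · rw [if_pos (Or.inr hb), if_neg ha, if_pos hb, zero_add]
          · rw [if_neg (by tauto), if_neg ha, if_neg hb, zero_add]
    _ = 2 * C := by rw [ENNReal.tsum_add, h1, h1, two_mul]

/-- **Exits are few**: over a label with `≤ N` sites and two admissible words there are `≤ 2N` exit vertices. [folklore] -/
theorem tsum_indicator_exit_le {N : ℝ≥0∞} {P : ℤ × ℤ × ℤ}
    (hN : ∑' u : Site 3, {u : Site 3 | PV P u}.indicator (fun _ => (1 : ℝ≥0∞)) u ≤ N)
    (w₁ w₂ : List (ℤ × ℤ × ℤ)) (C : ℝ≥0∞) :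
    ∑' b : Site 3 × List (ℤ × ℤ × ℤ),
      {b : Site 3 × List (ℤ × ℤ × ℤ) | PV P b.1 ∧ (b.2 = w₁ ∨ b.2 = w₂)}.indicator (fun _ => C) b ≤ 2 * N * C := by
  classical
  rw [ENNReal.tsum_prod']
  have h : ∀ v : Site 3, ∑' w : List (ℤ × ℤ × ℤ),
      {b : Site 3 × List (ℤ × ℤ × ℤ) | PV P b.1 ∧ (b.2 = w₁ ∨ b.2 = w₂)}.indicator (fun _ => C) (v, w) =
      {u : Site 3 | PV P u}.indicator
        (fun _ => ∑' w : List (ℤ × ℤ × ℤ), {w : List (ℤ × ℤ × ℤ) | w = w₁ ∨ w = w₂}.indicator (fun _ => C) w) v := by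
    intro v
    by_cases hv : PV P v
    · rw [Set.indicator_of_mem (show v ∈ {u : Site 3 | PV P u} from hv)]
      refine tsum_congr fun w => ?_
      simp only [Set.indicator_apply, Set.mem_setOf_eq]
      by_cases hw : w = w₁ ∨ w = w₂
      · rw [if_pos ⟨hv, hw⟩, if_pos hw]
      · rw [if_neg (fun h => hw h.2), if_neg hw]
    · rw [Set.indicator_of_notMem (show v ∉ {u : Site 3 | PV P u} from hv)]
      refine ENNReal.tsum_eq_zero.2 fun w => ?_
      rw [Set.indicator_of_notMem]
      exact fun h => hv h.1
  rw [tsum_congr h]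
  calc ∑' v : Site 3, {u : Site 3 | PV P u}.indicator
        (fun _ => ∑' w : List (ℤ × ℤ × ℤ), {w : List (ℤ × ℤ × ℤ) | w = w₁ ∨ w = w₂}.indicator (fun _ => C) w) v
      ≤ N * (2 * C) := tsum_indicator_le_mul PV hN fun u _ => tsum_indicator_two_words_le w₁ w₂ C
    _ = 2 * N * C := by ring

/-- **Entries over a fixed word**: `Σ_{a : a.2 = w₀, a.1 over P} g(a.1) = Σ_{u over P} g(u)`. [folklore] -/
theorem tsum_indicator_entry_eq (P : ℤ × ℤ × ℤ) (w₀ : List (ℤ × ℤ × ℤ)) (g : Site 3 → ℝ≥0∞) :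
    ∑' a : Site 3 × List (ℤ × ℤ × ℤ),
      {a : Site 3 × List (ℤ × ℤ × ℤ) | PV P a.1 ∧ a.2 = w₀}.indicator (fun a => g a.1) a =
      ∑' u : Site 3, {u : Site 3 | PV P u}.indicator g u := by
  classical
  rw [ENNReal.tsum_prod']
  refine tsum_congr fun v => ?_
  rw [tsum_eq_single w₀ fun w hw => by
    rw [Set.indicator_of_notMem]
    exact fun h => hw h.2]
  simp only [Set.indicator_apply, Set.mem_setOf_eq, and_true]

/-- **One label per site**: `Σ_P [u over P] C ≤ C`. [folklore] -/
theorem tsum_indicator_label_le (huniq : ∀ (u : Site 3) (P P' : ℤ × ℤ × ℤ), PV P u → PV P' u → P = P')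
    (u : Site 3) (C : ℝ≥0∞) :
    ∑' P : ℤ × ℤ × ℤ, {P : ℤ × ℤ × ℤ | PV P u}.indicator (fun _ => C) P ≤ C := by
  classical
  by_cases h : ∃ P₀, PV P₀ u
  · obtain ⟨P₀, hP₀⟩ := h
    rw [tsum_eq_single P₀ fun P hP => by
      rw [Set.indicator_of_notMem]
      exact fun h => hP (huniq u P P₀ h hP₀)]
    rw [Set.indicator_of_mem (show P₀ ∈ {P : ℤ × ℤ × ℤ | PV P u} from hP₀)]
  · push Not at h
    rw [ENNReal.tsum_eq_zero.2 fun P => by rw [Set.indicator_of_notMem]; exact h P]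
    exact bot_le

/-- `Σ_{n ∈ ℤ} ν^{|n|} ≤ 4` for `ν ≤ 1/2`. [folklore] -/
theorem tsum_pow_natAbs_le {ν : ℝ≥0∞} (hν : ν ≤ 2⁻¹) : ∑' n : ℤ, ν ^ n.natAbs ≤ 4 := by
  have hs : Function.Surjective fun q : ℕ × Bool => if q.2 then (q.1 : ℤ) else -(q.1 : ℤ) := by
    intro n
    rcases le_or_gt 0 n with h | h
    · exact ⟨(n.toNat, true), by simp [Int.toNat_of_nonneg h]⟩
    · exact ⟨((-n).toNat, false), by simp [Int.toNat_of_nonneg (by omega : 0 ≤ -n)]⟩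
  have hgeo : ∑' n : ℕ, ν ^ n ≤ 2 := by
    calc ∑' n : ℕ, ν ^ n ≤ ∑' n : ℕ, (2⁻¹ : ℝ≥0∞) ^ n := ENNReal.tsum_le_tsum fun n => pow_le_pow_left' hν n
      _ = 2 := by rw [ENNReal.tsum_geometric, ENNReal.one_sub_inv_two, inv_inv]
  calc ∑' n : ℤ, ν ^ n.natAbs ≤ ∑' q : ℕ × Bool, ν ^ (if q.2 then (q.1 : ℤ) else -(q.1 : ℤ)).natAbs :=
        ENNReal.tsum_le_tsum_comp_of_surjective hs _
    _ = ∑' n : ℕ, ∑' b : Bool, ν ^ (if b then (n : ℤ) else -(n : ℤ)).natAbs := ENNReal.tsum_prod'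
    _ = ∑' n : ℕ, (ν ^ n + ν ^ n) := by
        refine tsum_congr fun n => ?_
        rw [tsum_bool]
        simp
    _ = (∑' n : ℕ, ν ^ n) + ∑' n : ℕ, ν ^ n := ENNReal.tsum_add
    _ ≤ 2 + 2 := add_le_add hgeo hgeo
    _ = 4 := by norm_num

/-- `Σ_{Q ∈ ℤ³} ν^{‖Q − P‖₁} ≤ 64` for `ν ≤ 1/2` (labels `ℤ × ℤ × ℤ`). [folklore] -/
theorem tsum_pow_norm_le {ν : ℝ≥0∞} (hν : ν ≤ 2⁻¹) (P : ℤ × ℤ × ℤ) :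
    ∑' Q : ℤ × ℤ × ℤ, ν ^ ((Q.1 - P.1).natAbs + (Q.2.1 - P.2.1).natAbs + (Q.2.2 - P.2.2).natAbs) ≤ 64 := by
  have h4 := tsum_pow_natAbs_le hν
  rw [← (Equiv.addRight P).tsum_eq]
  simp only [Equiv.coe_addRight, Prod.fst_add, Prod.snd_add, add_sub_cancel_right]
  have hsplit : (∑' a : ℤ, ν ^ a.natAbs) * ((∑' b : ℤ, ν ^ b.natAbs) * ∑' c : ℤ, ν ^ c.natAbs) =
      ∑' Q : ℤ × ℤ × ℤ, ν ^ (Q.1.natAbs + Q.2.1.natAbs + Q.2.2.natAbs) := by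
    rw [← ENNReal.tsum_mul_right, ENNReal.tsum_prod']
    refine tsum_congr fun a => ?_
    rw [← ENNReal.tsum_mul_right, ← ENNReal.tsum_mul_left, ENNReal.tsum_prod']
    refine tsum_congr fun b => ?_
    rw [← ENNReal.tsum_mul_left, ← ENNReal.tsum_mul_left]
    refine tsum_congr fun c => ?_
    dsimp only
    rw [pow_add, pow_add, mul_assoc]
  rw [← hsplit]
  calc (∑' a : ℤ, ν ^ a.natAbs) * ((∑' b : ℤ, ν ^ b.natAbs) * ∑' c : ℤ, ν ^ c.natAbs)
      ≤ 4 * (4 * 4) := mul_le_mul' h4 (mul_le_mul' h4 h4)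
    _ = 64 := by norm_num

/-! ### The first-visit recurrence -/

/-- First-visit decomposition of the chain CONDITIONS under `Fin.cons`. [folklore] -/
theorem chainCond_cons_iff (σ : (Site 3 × List (ℤ × ℤ × ℤ))) (R : (ℤ × ℤ × ℤ) → Prop) {k : ℕ} (c₀ : (ℤ × ℤ × ℤ) × (Site 3 × List (ℤ × ℤ × ℤ)) × (Site 3 × List (ℤ × ℤ × ℤ)))
    (c : Fin k → (ℤ × ℤ × ℤ) × (Site 3 × List (ℤ × ℤ × ℤ)) × (Site 3 × List (ℤ × ℤ × ℤ))) :
    ((∀ i : Fin (k + 1), (PV ((Fin.cons c₀ c : Fin (k + 1) → (ℤ × ℤ × ℤ) × (Site 3 × List (ℤ × ℤ × ℤ)) × (Site 3 × List (ℤ × ℤ × ℤ))) i).1 ((Fin.cons c₀ c : Fin (k + 1) → (ℤ × ℤ × ℤ) × (Site 3 × List (ℤ × ℤ × ℤ)) × (Site 3 × List (ℤ × ℤ × ℤ))) i).2.1.1 ∧ PV ((Fin.cons c₀ c : Fin (k + 1) → (ℤ × ℤ × ℤ) × (Site 3 × List (ℤ × ℤ × ℤ)) × (Site 3 × List (ℤ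 × ℤ × ℤ))) i).1 ((Fin.cons c₀ c : Fin (k + 1) → (ℤ × ℤ × ℤ) × (Site 3 × List (ℤ × ℤ × ℤ)) × (Site 3 × List (ℤ × ℤ × ℤ))) i).2.2.1 ∧ (((Fin.cons c₀ c : Fin (k + 1) → (ℤ × ℤ × ℤ) × (Site 3 × List (ℤ × ℤ × ℤ)) × (Site 3 × List (ℤ × ℤ × ℤ))) i).2.2.2 = ((Fin.cons c₀ c : Fin (k + 1) → (ℤ × ℤ × ℤ) × (Site 3 × List (ℤ × ℤ × ℤ)) × (Site 3 × List (ℤ × ℤ × ℤ))) i).2.1.2 ∨ ((Fin.cons c₀ c : Fin (k + 1) → (ℤ × ℤ × ℤ) × (Site 3 × List (ℤ × ℤ × ℤ)) × (Site 3 × List (ℤ × ℤ × ℤ))) i).2.2.2 = op ((Fin.cons c₀ c : Fin (k + 1) → (ℤ × ℤ × ℤ) × (Site 3 × List (ℤ × ℤ × ℤ)) × (Site 3 × List (ℤ × ℤ × ℤ))) i).1 ((Fin.cons c₀ c : Fin (k + 1) → (ℤ × ℤ × ℤ) × (Site 3 × List (ℤ × ℤ × ℤ)) × (Site 3 × List (ℤ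 × ℤ × ℤ))) i).2.1.2) ∧
          ((Fin.cons c₀ c : Fin (k + 1) → (ℤ × ℤ × ℤ) × (Site 3 × List (ℤ × ℤ × ℤ)) × (Site 3 × List (ℤ × ℤ × ℤ))) i).2.1.2 = (if _h : i.1 = 0 then σ else ((Fin.cons c₀ c : Fin (k + 1) → (ℤ × ℤ × ℤ) × (Site 3 × List (ℤ × ℤ × ℤ)) × (Site 3 × List (ℤ × ℤ × ℤ))) ⟨i.1 - 1, by omega⟩).2.2).2)) ∧
        (∀ (i : Fin (k + 1)) (h : i.1 + 1 < (k + 1)), ((Fin.cons c₀ c : Fin (k + 1) → (ℤ × ℤ × ℤ) × (Site 3 × List (ℤ × ℤ × ℤ)) × (Site 3 × List (ℤ × ℤ × ℤ))) i).1 ≠ ((Fin.cons c₀ c : Fin (k + 1) → (ℤ × ℤ × ℤ) × (Site 3 × List (ℤ × ℤ × ℤ)) × (Site 3 × List (ℤ × ℤ × ℤ))) ⟨i.1 + 1, h⟩).1) ∧ (∀ h : 0 < (k + 1), R ((Fin.cons c₀ c : Fin (k + 1) → (ℤ × ℤ × ℤ) × (Site 3 × List (ℤ × ℤ × ℤ))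 × (Site 3 × List (ℤ × ℤ × ℤ))) ⟨0, h⟩).1)) ↔
    ((PV c₀.1 c₀.2.1.1 ∧ PV c₀.1 c₀.2.2.1 ∧ (c₀.2.2.2 = c₀.2.1.2 ∨ c₀.2.2.2 = op c₀.1 c₀.2.1.2) ∧ c₀.2.1.2 = σ.2 ∧ R c₀.1) ∧
      ((∀ i : Fin k, (PV (c i).1 (c i).2.1.1 ∧ PV (c i).1 (c i).2.2.1 ∧ ((c i).2.2.2 = (c i).2.1.2 ∨ (c i).2.2.2 = op (c i).1 (c i).2.1.2) ∧
          (c i).2.1.2 = (if _h : i.1 = 0 then c₀.2.2 else (c ⟨i.1 - 1, by omega⟩).2.2).2)) ∧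
        (∀ (i : Fin k) (h : i.1 + 1 < k), (c i).1 ≠ (c ⟨i.1 + 1, h⟩).1) ∧ (∀ h : 0 < k, (c ⟨0, h⟩).1 ≠ c₀.1))) := by
  have e0 : ∀ h : 0 < k + 1, ((Fin.cons c₀ c : Fin (k + 1) → (ℤ × ℤ × ℤ) × (Site 3 × List (ℤ × ℤ × ℤ)) × (Site 3 × List (ℤ × ℤ × ℤ))) ⟨0, h⟩) = c₀ := fun h => rfl
  have es : ∀ (i : ℕ) (h : i + 1 < k + 1), ((Fin.cons c₀ c : Fin (k + 1) → (ℤ × ℤ × ℤ) × (Site 3 × List (ℤ × ℤ × ℤ)) × (Site 3 × List (ℤ × ℤ × ℤ))) ⟨i + 1, h⟩) = c ⟨i, by omega⟩ := fun i h => rfl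
  -- the source vertex seen from the tail chain
  have esrc : ∀ (i : ℕ) (hi : i + 1 < k + 1),
      (if _h : i + 1 = 0 then σ else ((Fin.cons c₀ c : Fin (k + 1) → (ℤ × ℤ × ℤ) × (Site 3 × List (ℤ × ℤ × ℤ)) × (Site 3 × List (ℤ × ℤ × ℤ))) ⟨i + 1 - 1, by omega⟩).2.2) =
        (if _h : i = 0 then c₀.2.2 else (c ⟨i - 1, by omega⟩).2.2) := by
    intro i hi
    rw [dif_neg (by omega)]
    by_cases hi0 : i = 0
    · subst hi0; rw [dif_pos rfl]; rfl
    · rw [dif_neg hi0]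
      obtain ⟨i₀, rfl⟩ : ∃ i₀ : ℕ, i = i₀ + 1 := ⟨i - 1, by omega⟩
      have h1 : (⟨i₀ + 1 + 1 - 1, by omega⟩ : Fin (k + 1)) = ⟨i₀ + 1, by omega⟩ := Fin.ext (by simp)
      have h2 : (⟨i₀ + 1 - 1, by omega⟩ : Fin k) = ⟨i₀, by omega⟩ := Fin.ext (by simp)
      rw [h1, h2, es]
  constructor
  · rintro ⟨hall, hcons, hR⟩
    refine ⟨⟨?_, ?_, ?_, ?_, ?_⟩, ⟨fun i => ?_, fun i h => ?_, fun h => ?_⟩⟩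
    · have := (hall ⟨0, by omega⟩).1; rwa [e0] at this
    · have := (hall ⟨0, by omega⟩).2.1; rwa [e0] at this
    · have := (hall ⟨0, by omega⟩).2.2.1; rwa [e0] at this
    · have := (hall ⟨0, by omega⟩).2.2.2; rwa [e0, dif_pos rfl] at this
    · have := hR (by omega); rwa [e0] at this
    · have := hall ⟨i.1 + 1, by omega⟩
      rwa [es i.1 (by omega), esrc i.1 (by omega)] at this
    · have := hcons ⟨i.1 + 1, by omega⟩ (by simp only; omega)
      rwa [es i.1 (by omega), es (i.1 + 1) (by omega)] at this
    · have := hcons ⟨0, by omega⟩ (by simp only; omega)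
      rw [e0, es 0 (by omega)] at this
      exact fun h' => this h'.symm
  · rintro ⟨⟨ha, hb, hw, hsrc, hR⟩, hall, hcons, hfirst⟩
    refine ⟨fun i => ?_, fun i h => ?_, fun h => by rw [e0]; exact hR⟩
    · obtain ⟨n, hn⟩ := i
      cases n with
      | zero => rw [e0, dif_pos rfl]; exact ⟨ha, hb, hw, hsrc⟩
      | succ n => rw [es n hn, esrc n hn]; exact hall ⟨n, by omega⟩
    · obtain ⟨n, hn⟩ := i
      cases n with
      | zero =>
          rw [e0]
          have h1 : (0 : ℕ) + 1 < k + 1 := h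
          rw [es 0 h1]
          exact fun h' => hfirst (by omega) h'.symm
      | succ n =>
          have h1 : n + 1 + 1 < k + 1 := h
          rw [es n hn, es (n + 1) h1]
          exact hcons ⟨n, by omega⟩ (by simp only; omega)

/-- The last exit vertex of a `Fin.cons` chain is that of its tail (read from the first exit). [folklore] -/
theorem last_cons (σ : (Site 3 × List (ℤ × ℤ × ℤ))) {k : ℕ} (c₀ : (ℤ × ℤ × ℤ) × (Site 3 × List (ℤ × ℤ × ℤ)) × (Site 3 × List (ℤ × ℤ × ℤ))) (c : Fin k → (ℤ × ℤ × ℤ) × (Site 3 × List (ℤ × ℤ × ℤ)) × (Site 3 × List (ℤ × ℤ × ℤ))) :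
    (if _h : k + 1 = 0 then σ else ((Fin.cons c₀ c : Fin (k + 1) → (ℤ × ℤ × ℤ) × (Site 3 × List (ℤ × ℤ × ℤ)) × (Site 3 × List (ℤ × ℤ × ℤ))) ⟨k + 1 - 1, by omega⟩).2.2) =
      (if _h : k = 0 then c₀.2.2 else (c ⟨k - 1, by omega⟩).2.2) := by
  rw [dif_neg (by omega)]
  cases k with
  | zero => rw [dif_pos rfl]; rfl
  | succ k =>
      rw [dif_neg (by omega)]
      have h1 : (⟨k + 1 + 1 - 1, by omega⟩ : Fin (k + 1 + 1)) = ⟨k + 1, by omega⟩ := Fin.ext (by simp)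
      have h2 : (⟨k + 1 - 1, by omega⟩ : Fin (k + 1)) = ⟨k, by omega⟩ := Fin.ext (by simp)
      rw [h1, h2]
      rfl

/-- First-visit decomposition of the chain WEIGHT under `Fin.cons`:
`W_{k+1}(σ; c₀ :: c; x) = T(a₀.1 − σ.1) · W_k(b₀; c; x)`. [folklore] -/
theorem weight_cons (σ x : (Site 3 × List (ℤ × ℤ × ℤ))) {k : ℕ} (c₀ : (ℤ × ℤ × ℤ) × (Site 3 × List (ℤ × ℤ × ℤ)) × (Site 3 × List (ℤ × ℤ × ℤ))) (c : Fin k → (ℤ × ℤ × ℤ) × (Site 3 × List (ℤ × ℤ × ℤ)) × (Site 3 × List (ℤ × ℤ × ℤ))) :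
    (∏ i : Fin (k + 2), T ((if h : i.1 < (k + 1) then ((Fin.cons c₀ c : Fin (k + 1) → (ℤ × ℤ × ℤ) × (Site 3 × List (ℤ × ℤ × ℤ)) × (Site 3 × List (ℤ × ℤ × ℤ))) ⟨i.1, h⟩).2.1 else x).1 - (if _h : i.1 = 0 then σ else ((Fin.cons c₀ c : Fin (k + 1) → (ℤ × ℤ × ℤ) × (Site 3 × List (ℤ × ℤ × ℤ)) × (Site 3 × List (ℤ × ℤ × ℤ))) ⟨i.1 - 1, by omega⟩).2.2).1)) =
      T (c₀.2.1.1 - σ.1) * (∏ i : Fin (k + 1), T ((if h : i.1 < k then (c ⟨i.1, h⟩).2.1 else x).1 - (if _h : i.1 = 0 then c₀.2.2 else (c ⟨i.1 - 1, by omega⟩).2.2).1)) := by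
  rw [Fin.prod_univ_succ]
  refine congrArg₂ (· * ·) rfl ?_
  refine Finset.prod_congr rfl fun i _ => ?_
  have hv : (i.succ : Fin (k + 2)).1 = i.1 + 1 := rfl
  congr 1
  congr 2
  · by_cases hik : i.1 < k
    · rw [dif_pos (by rw [hv]; omega), dif_pos hik]
      rfl
    · rw [dif_neg (by rw [hv]; omega), dif_neg hik]
  · rw [dif_neg (by rw [hv]; omega)]
    by_cases hi0 : i.1 = 0
    · rw [dif_pos hi0]
      have : (⟨(i.succ : Fin (k + 2)).1 - 1, by rw [hv]; omega⟩ : Fin (k + 1)) = 0 := Fin.ext (by simp [hi0])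
      rw [this]
      rfl
    · rw [dif_neg hi0]
      obtain ⟨i₀, hi₀⟩ : ∃ i₀ : ℕ, i.1 = i₀ + 1 := ⟨i.1 - 1, by omega⟩
      have h1 : (⟨(i.succ : Fin (k + 2)).1 - 1, by rw [hv]; omega⟩ : Fin (k + 1)) = ⟨i₀ + 1, by omega⟩ :=
        Fin.ext (by simp [hi₀])
      have h2 : (⟨i.1 - 1, by omega⟩ : Fin k) = ⟨i₀, by omega⟩ := Fin.ext (by simp [hi₀])
      rw [h1, h2]
      rfl

/-- **First-visit recurrence for the level sums**: splitting a chain of `k + 1` core visits from `σ` into its first visit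
`c₀ = (P₀, a₀, b₀)` and the remaining chain from `b₀` (whose first label must differ from `P₀`):
`L_{k+1}(σ; R) = Σ_{c₀ admissible, R P₀} T(a₀.1 − σ.1) · L_k(b₀; · ≠ P₀)`. [cite: AizenmanNewman1984, §4] -/
theorem levelSum_succ (σ : (Site 3 × List (ℤ × ℤ × ℤ))) (R : (ℤ × ℤ × ℤ) → Prop) (k : ℕ) :
    (∑' c : Fin (k + 1) → (ℤ × ℤ × ℤ) × (Site 3 × List (ℤ × ℤ × ℤ)) × (Site 3 × List (ℤ × ℤ × ℤ)),
      {c : Fin (k + 1) → (ℤ × ℤ × ℤ) × (Site 3 × List (ℤ × ℤ × ℤ)) × (Site 3 × List (ℤ × ℤ × ℤ)) |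
        ((∀ i : Fin (k + 1), (PV (c i).1 (c i).2.1.1 ∧ PV (c i).1 (c i).2.2.1 ∧ ((c i).2.2.2 = (c i).2.1.2 ∨ (c i).2.2.2 = op (c i).1 (c i).2.1.2) ∧
          (c i).2.1.2 = (if _h : i.1 = 0 then σ else (c ⟨i.1 - 1, by omega⟩).2.2).2)) ∧
        (∀ (i : Fin (k + 1)) (h : i.1 + 1 < (k + 1)), (c i).1 ≠ (c ⟨i.1 + 1, h⟩).1) ∧ (∀ h : 0 < (k + 1), R (c ⟨0, h⟩).1))}.indicator
        (fun c => (∑' x : (Site 3 × List (ℤ × ℤ × ℤ)), {x : (Site 3 × List (ℤ × ℤ × ℤ)) | x.2 = (if _h : (k + 1) = 0 then σ else (c ⟨(k + 1) - 1, by omega⟩).2.2).2}.indicator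
          (fun x => (∏ i : Fin (k + 2), T ((if h : i.1 < (k + 1) then (c ⟨i.1, h⟩).2.1 else x).1 - (if _h : i.1 = 0 then σ else (c ⟨i.1 - 1, by omega⟩).2.2).1))) x)) c) =
    ∑' c₀ : (ℤ × ℤ × ℤ) × (Site 3 × List (ℤ × ℤ × ℤ)) × (Site 3 × List (ℤ × ℤ × ℤ)),
      {c₀ : (ℤ × ℤ × ℤ) × (Site 3 × List (ℤ × ℤ × ℤ)) × (Site 3 × List (ℤ × ℤ × ℤ)) | (PV c₀.1 c₀.2.1.1 ∧ PV c₀.1 c₀.2.2.1 ∧ (c₀.2.2.2 = c₀.2.1.2 ∨ c₀.2.2.2 = op c₀.1 c₀.2.1.2) ∧ c₀.2.1.2 = σ.2 ∧ R c₀.1)}.indicator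
        (fun c₀ => T (c₀.2.1.1 - σ.1) *
          (∑' c : Fin k → (ℤ × ℤ × ℤ) × (Site 3 × List (ℤ × ℤ × ℤ)) × (Site 3 × List (ℤ × ℤ × ℤ)),
      {c : Fin k → (ℤ × ℤ × ℤ) × (Site 3 × List (ℤ × ℤ × ℤ)) × (Site 3 × List (ℤ × ℤ × ℤ)) |
        ((∀ i : Fin k, (PV (c i).1 (c i).2.1.1 ∧ PV (c i).1 (c i).2.2.1 ∧ ((c i).2.2.2 = (c i).2.1.2 ∨ (c i).2.2.2 = op (c i).1 (c i).2.1.2) ∧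
          (c i).2.1.2 = (if _h : i.1 = 0 then c₀.2.2 else (c ⟨i.1 - 1, by omega⟩).2.2).2)) ∧
        (∀ (i : Fin k) (h : i.1 + 1 < k), (c i).1 ≠ (c ⟨i.1 + 1, h⟩).1) ∧ (∀ h : 0 < k, (c ⟨0, h⟩).1 ≠ c₀.1))}.indicator
        (fun c => (∑' x : (Site 3 × List (ℤ × ℤ × ℤ)), {x : (Site 3 × List (ℤ × ℤ × ℤ)) | x.2 = (if _h : k = 0 then c₀.2.2 else (c ⟨k - 1, by omega⟩).2.2).2}.indicator
          (fun x => (∏ i : Fin (k + 1), T ((if h : i.1 < k then (c ⟨i.1, h⟩).2.1 else x).1 - (if _h : i.1 = 0 then c₀.2.2 else (c ⟨i.1 - 1, by omega⟩).2.2).1))) x)) c)) c₀ := by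
  classical
  rw [← (Fin.consEquiv fun _ : Fin (k + 1) => (ℤ × ℤ × ℤ) × (Site 3 × List (ℤ × ℤ × ℤ)) × (Site 3 × List (ℤ × ℤ × ℤ))).tsum_eq, ENNReal.tsum_prod']
  refine tsum_congr fun c₀ => ?_
  have hmul : ∀ (S : Set (Fin k → (ℤ × ℤ × ℤ) × (Site 3 × List (ℤ × ℤ × ℤ)) × (Site 3 × List (ℤ × ℤ × ℤ)))) (f : (Fin k → (ℤ × ℤ × ℤ) × (Site 3 × List (ℤ × ℤ × ℤ)) × (Site 3 × List (ℤ × ℤ × ℤ))) → ℝ≥0∞) (c : Fin k → (ℤ × ℤ × ℤ) × (Site 3 × List (ℤ × ℤ × ℤ)) × (Site 3 × List (ℤ × ℤ × ℤ))),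
      T (c₀.2.1.1 - σ.1) * S.indicator f c = S.indicator (fun c => T (c₀.2.1.1 - σ.1) * f c) c :=
    fun S f c => (Set.indicator_mul_right S (fun _ => T (c₀.2.1.1 - σ.1)) f).symm
  by_cases hP : (PV c₀.1 c₀.2.1.1 ∧ PV c₀.1 c₀.2.2.1 ∧ (c₀.2.2.2 = c₀.2.1.2 ∨ c₀.2.2.2 = op c₀.1 c₀.2.1.2) ∧ c₀.2.1.2 = σ.2 ∧ R c₀.1)
  · rw [Set.indicator_of_mem (show c₀ ∈ {c₀ : (ℤ × ℤ × ℤ) × (Site 3 × List (ℤ × ℤ × ℤ)) × (Site 3 × List (ℤ × ℤ × ℤ)) | (PV c₀.1 c₀.2.1.1 ∧ PV c₀.1 c₀.2.2.1 ∧ (c₀.2.2.2 = c₀.2.1.2 ∨ c₀.2.2.2 = op c₀.1 c₀.2.1.2) ∧ c₀.2.1.2 = σ.2 ∧ R c₀.1)} from hP), ← ENNReal.tsum_mul_left]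
    refine tsum_congr fun c => ?_
    rw [hmul]
    have hce : (Fin.consEquiv fun _ : Fin (k + 1) => (ℤ × ℤ × ℤ) × (Site 3 × List (ℤ × ℤ × ℤ)) × (Site 3 × List (ℤ × ℤ × ℤ))) (c₀, c) = (Fin.cons c₀ c : Fin (k + 1) → (ℤ × ℤ × ℤ) × (Site 3 × List (ℤ × ℤ × ℤ)) × (Site 3 × List (ℤ × ℤ × ℤ))) := rfl
    rw [hce]
    have hmem := chainCond_cons_iff PV op σ R c₀ c
    simp only [Set.indicator_apply, Set.mem_setOf_eq]
    by_cases hC : ((∀ i : Fin k, (PV (c i).1 (c i).2.1.1 ∧ PV (c i).1 (c i).2.2.1 ∧ ((c i).2.2.2 = (c i).2.1.2 ∨ (c i).2.2.2 = op (c i).1 (c i).2.1.2) ∧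
          (c i).2.1.2 = (if _h : i.1 = 0 then c₀.2.2 else (c ⟨i.1 - 1, by omega⟩).2.2).2)) ∧
        (∀ (i : Fin k) (h : i.1 + 1 < k), (c i).1 ≠ (c ⟨i.1 + 1, h⟩).1) ∧ (∀ h : 0 < k, (c ⟨0, h⟩).1 ≠ c₀.1))
    · rw [if_pos (hmem.2 ⟨hP, hC⟩), if_pos hC, last_cons, ← ENNReal.tsum_mul_left]
      refine tsum_congr fun x => ?_
      by_cases hx : x.2 = (if _h : k = 0 then c₀.2.2 else (c ⟨k - 1, by omega⟩).2.2).2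
      · rw [if_pos hx, if_pos hx]
        exact weight_cons T σ x c₀ c
      · rw [if_neg hx, if_neg hx, mul_zero]
    · rw [if_neg (fun h => hC (hmem.1 h).2), if_neg hC]
  · rw [Set.indicator_of_notMem (show c₀ ∉ {c₀ : (ℤ × ℤ × ℤ) × (Site 3 × List (ℤ × ℤ × ℤ)) × (Site 3 × List (ℤ × ℤ × ℤ)) | (PV c₀.1 c₀.2.1.1 ∧ PV c₀.1 c₀.2.2.1 ∧ (c₀.2.2.2 = c₀.2.1.2 ∨ c₀.2.2.2 = op c₀.1 c₀.2.1.2) ∧ c₀.2.1.2 = σ.2 ∧ R c₀.1)} from hP)]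
    refine ENNReal.tsum_eq_zero.2 fun c => ?_
    have hce : (Fin.consEquiv fun _ : Fin (k + 1) => (ℤ × ℤ × ℤ) × (Site 3 × List (ℤ × ℤ × ℤ)) × (Site 3 × List (ℤ × ℤ × ℤ))) (c₀, c) = (Fin.cons c₀ c : Fin (k + 1) → (ℤ × ℤ × ℤ) × (Site 3 × List (ℤ × ℤ × ℤ)) × (Site 3 × List (ℤ × ℤ × ℤ))) := rfl
    rw [hce, Set.indicator_of_notMem]
    exact fun h => hP ((chainCond_cons_iff PV op σ R c₀ c).1 h).1

/-- **The level-zero sum is the susceptibility**: with no core visit the weight is `T(x.1 − σ.1)` over the endpoints `x` carrying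
the word of `σ`, summing to `χ_T = Σ_v T(v)`. [folklore] -/
theorem levelSum_zero (σ : (Site 3 × List (ℤ × ℤ × ℤ))) (R : (ℤ × ℤ × ℤ) → Prop) :
    (∑' c : Fin 0 → (ℤ × ℤ × ℤ) × (Site 3 × List (ℤ × ℤ × ℤ)) × (Site 3 × List (ℤ × ℤ × ℤ)),
      {c : Fin 0 → (ℤ × ℤ × ℤ) × (Site 3 × List (ℤ × ℤ × ℤ)) × (Site 3 × List (ℤ × ℤ × ℤ)) |
        ((∀ i : Fin 0, (PV (c i).1 (c i).2.1.1 ∧ PV (c i).1 (c i).2.2.1 ∧ ((c i).2.2.2 = (c i).2.1.2 ∨ (c i).2.2.2 = op (c i).1 (c i).2.1.2) ∧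
          (c i).2.1.2 = (if _h : i.1 = 0 then σ else (c ⟨i.1 - 1, by omega⟩).2.2).2)) ∧
        (∀ (i : Fin 0) (h : i.1 + 1 < 0), (c i).1 ≠ (c ⟨i.1 + 1, h⟩).1) ∧ (∀ h : 0 < 0, R (c ⟨0, h⟩).1))}.indicator
        (fun c => (∑' x : (Site 3 × List (ℤ × ℤ × ℤ)), {x : (Site 3 × List (ℤ × ℤ × ℤ)) | x.2 = (if _h : 0 = 0 then σ else (c ⟨0 - 1, by omega⟩).2.2).2}.indicator
          (fun x => (∏ i : Fin 1, T ((if h : i.1 < 0 then (c ⟨i.1, h⟩).2.1 else x).1 - (if _h : i.1 = 0 then σ else (c ⟨i.1 - 1, by omega⟩).2.2).1))) x)) c) = ∑' v : Site 3, T v := by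
  classical
  rw [tsum_fintype, Fintype.sum_unique, Set.indicator_of_mem (by
    exact ⟨fun i => i.elim0, fun i => i.elim0, fun h => absurd h (lt_irrefl 0)⟩), ENNReal.tsum_prod',
    ← (Equiv.subRight σ.1).tsum_eq T]
  refine tsum_congr fun u => ?_
  rw [tsum_eq_single σ.2 fun w hw => by
    rw [Set.indicator_of_notMem]
    · exact hw]
  simp


/-- `Σ_{n ∈ ℤ} ν^{|n|}` is finite for `ν ≤ 1/2` (re-commit corollary of `tsum_pow_natAbs_le`). [folklore] -/
theorem tsum_pow_natAbs_ne_top {ν : ℝ≥0∞} (hν : ν ≤ 2⁻¹) : ∑' n : ℤ, ν ^ n.natAbs ≠ ∞ :=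
  ne_top_of_le_ne_top (by norm_num) (tsum_pow_natAbs_le hν)

end CoverSubcritTransfer

end Summit.CriticalPhenomena.PercolationContinuityZ3.Theorems

end
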